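import Mathlib
import Summits.Ventures.PercRepro2.Defs
import Summits.Ventures.PercRepro2.Graph
import Summits.Ventures.PercRepro2.OneColourSwitch

/-!
# Loops and the connection-transfer lemmas for the pendant / series reductions of `m9`
(blind cell PercRepro2, p3 g19, 2026-08-27)

Tools for the exact reductions of `M9PendantSeries`: a removed edge is turned into a LOOP at a
non-mark `d` by `Function.update`; a loop never yields an open adjacency (`openGraph_adj` needs
distinct endpoints), so it is invisible to every connection.  The three TRANSFER lemmas say, for
`a, b ≠ d`, that the connection `a ↔ b` is unchanged when

* the only non-loop edge `e₀ = {d, v}` of `d` is looped (`conn_pendantLoop_iff`);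
* the two non-loop edges `e₁ = {d, x}`, `e₂ = {d, y}` of `d` carry the SAME colour and `e₁` is
  replaced by the edge `{x, y}`, `e₂` looped (`conn_series_same_iff`);
* they carry DIFFERENT colours and both are looped (`conn_series_mixed_iff`: `d` is a dead end).

Every proof is a closure argument (`mem_of_conn_of_closed`) on a vertex set of the form
`{w | a ↔ w in the new graph} ∪ {d | …}`.  Own work, one seat.
-/

namespace Summit.Ventures.PercRepro2

namespace M9Reduce

open OneColourSwitch

variable {V : Type*} {E : Type*}

section Loops

variable [DecidableEq E] {ends : E → Sym2 V}

omit [DecidableEq E] in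
/-- A loop carries no open adjacency. -/
lemma not_openGraph_adj_of_isDiag {u v : V} {e : E} (hd : (ends e).IsDiag)
    (he : ends e = s(u, v)) (huv : u ≠ v) : False := by
  rw [he, Sym2.mk_isDiag_iff] at hd
  exact huv hd

/-- Recolouring a loop does not change any connection. -/
lemma conn_update_loop_of_conn {ω : Config E} {e₀ : E} (hd : (ends e₀).IsDiag) {b : Bool}
    {a c : V} (h : Conn ends ω a c) : Conn ends (Function.update ω e₀ b) a c := by
  refine mem_of_conn_of_closed (S := {v | Conn ends (Function.update ω e₀ b) a v}) ?_
    (conn_refl _ _ _) h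
  intro x hx y hxy
  obtain ⟨hne, e, he, hends⟩ := openGraph_adj.1 hxy
  have hee : e ≠ e₀ := by
    rintro rfl
    exact not_openGraph_adj_of_isDiag hd hends hne
  refine conn_trans hx (conn_of_openAdj ⟨e, ?_, hends⟩)
  rw [Function.update_of_ne hee]
  exact he

/-- Recolouring a loop does not change any connection (both directions). -/
lemma conn_update_loop_iff {ω : Config E} {e₀ : E} (hd : (ends e₀).IsDiag) {b : Bool}
    {a c : V} : Conn ends (Function.update ω e₀ b) a c ↔ Conn ends ω a c := by
  constructor
  · intro h
    have := conn_update_loop_of_conn (ends := ends) hd (b := ω e₀) h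
    rwa [Function.update_idem, Function.update_eq_self] at this
  · exact conn_update_loop_of_conn hd

/-- `compl` commutes with `Function.update`. -/
lemma compl_update (ω : Config E) (e₀ : E) (b : Bool) :
    OneColourSwitch.compl (Function.update ω e₀ b) =
      Function.update (OneColourSwitch.compl ω) e₀ (!b) := by
  funext e
  by_cases h : e = e₀
  · subst h; simp [OneColourSwitch.compl]
  · simp [OneColourSwitch.compl, Function.update_of_ne h]

end Loops


section Transfer

variable [DecidableEq E] {ends : E → Sym2 V}

omit [DecidableEq E] in
/-- A vertex all of whose open edges are loops is joined only to itself. -/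
lemma eq_of_conn_of_loops {ω : Config E} {x y : V}
    (h : ∀ e, x ∈ ends e → ω e = true → (ends e).IsDiag) (hc : Conn ends ω y x) : y = x := by
  by_contra hyx
  have key : x ∈ {w | w ≠ x} := by
    refine mem_of_conn_of_closed (S := {w | w ≠ x}) ?_ hyx hc
    intro u hu w huw
    obtain ⟨hne, e, he, hends⟩ := openGraph_adj.1 huw
    intro hwx
    subst hwx
    have hx : w ∈ ends e := by rw [hends]; exact Sym2.mem_mk_right _ _
    exact not_openGraph_adj_of_isDiag (h e hx he) hends hne
  exact key rfl

/-- Making an edge a loop only removes connections. -/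
lemma conn_of_conn_update_loop {ω : Config E} {e₀ : E} {d a b : V}
    (h : Conn (Function.update ends e₀ s(d, d)) ω a b) : Conn ends ω a b := by
  refine mem_of_conn_of_closed (S := {w | Conn ends ω a w}) ?_ (conn_refl _ _ _) h
  intro u hu w huw
  obtain ⟨hne, e, he, hends⟩ := openGraph_adj.1 huw
  have hee : e ≠ e₀ := by
    rintro rfl
    rw [Function.update_self] at hends
    exact not_openGraph_adj_of_isDiag (by simp) hends hne
  rw [Function.update_of_ne hee] at hends
  exact conn_trans hu (conn_of_openAdj ⟨e, he, hends⟩)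

/-- **Pendant transfer.** If the only non-loop edge at `d` is `e₀ = {d, v}`, then for `a, b ≠ d`
the connection `a ↔ b` is the same after `e₀` is made a loop. -/
lemma conn_pendantLoop_iff {ω : Config E} {e₀ : E} {d v : V}
    (hd : ∀ e, d ∈ ends e → ¬ (ends e).IsDiag → e = e₀) (he₀ : ends e₀ = s(d, v))
    {a b : V} (ha : a ≠ d) (hb : b ≠ d) :
    Conn ends ω a b ↔ Conn (Function.update ends e₀ s(d, d)) ω a b := by
  set ends' := Function.update ends e₀ s(d, d) with hends'
  -- in `ends'` every edge at `d` is a loop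
  have hiso : ∀ e, d ∈ ends' e → ω e = true → (ends' e).IsDiag := by
    intro e hde _
    by_cases hee : e = e₀
    · subst hee; simp [hends']
    · simp only [hends', Function.update_of_ne hee] at hde ⊢
      by_contra hnd
      exact hee (hd e hde hnd)
  constructor
  · intro h
    let S : Set V := {w | Conn ends' ω a w} ∪ {w | w = d ∧ ω e₀ = true ∧ Conn ends' ω a v}
    have hmem : b ∈ S := by
      refine mem_of_conn_of_closed (S := S) ?_ (Or.inl (conn_refl _ _ _)) h
      intro u hu w huw
      obtain ⟨hne, e, he, hends⟩ := openGraph_adj.1 huw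
      by_cases hee : e = e₀
      · subst hee
        rw [he₀] at hends
        rcases Sym2.eq_iff.1 hends with ⟨rfl, rfl⟩ | ⟨rfl, rfl⟩
        · -- `u = d`, `w = v`
          rcases hu with hu | ⟨_, _, hv⟩
          · exact absurd (eq_of_conn_of_loops hiso hu) ha
          · exact Or.inl hv
        · -- `u = v`, `w = d`
          rcases hu with hu | ⟨huv, _, _⟩
          · exact Or.inr ⟨rfl, he, hu⟩
          · exact absurd huv hne
      · have hends' : ends' e = s(u, w) := by
          rw [hends', Function.update_of_ne hee]; exact hends
        rcases hu with hu | ⟨rfl, _, _⟩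
        · exact Or.inl (conn_trans hu (conn_of_openAdj ⟨e, he, hends'⟩))
        · have hde : u ∈ ends e := by rw [hends]; exact Sym2.mem_mk_left _ _
          have hnd : ¬ (ends e).IsDiag := fun hdg =>
            not_openGraph_adj_of_isDiag hdg hends hne
          exact absurd (hd e hde hnd) hee
    rcases hmem with hmem | ⟨rfl, _, _⟩
    · exact hmem
    · exact absurd rfl hb
  · exact conn_of_conn_update_loop

/-- **Series transfer, same colour.** If the non-loop edges at `d` are exactly `e₁ = {d, x}` and
`e₂ = {d, y}` and `ω` gives them the same colour, then for `a, b ≠ d` the connection `a ↔ b` is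
the same after `e₁` is replaced by `{x, y}` and `e₂` made a loop. -/
lemma conn_series_same_iff {ω : Config E} {e₁ e₂ : E} {d x y : V} (hne : e₁ ≠ e₂)
    (hd : ∀ e, d ∈ ends e → ¬ (ends e).IsDiag → e = e₁ ∨ e = e₂)
    (h₁ : ends e₁ = s(d, x)) (h₂ : ends e₂ = s(d, y)) (hx : x ≠ d) (hy : y ≠ d)
    (hc : ω e₁ = ω e₂) {a b : V} (ha : a ≠ d) (hb : b ≠ d) :
    Conn ends ω a b ↔
      Conn (Function.update (Function.update ends e₁ s(x, y)) e₂ s(d, d)) ω a b := by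
  set ends₁ := Function.update (Function.update ends e₁ s(x, y)) e₂ s(d, d) with hends₁
  have hE₁ : ends₁ e₁ = s(x, y) := by
    simp only [hends₁, Function.update_of_ne hne, Function.update_self]
  have hE₂ : ends₁ e₂ = s(d, d) := by simp only [hends₁, Function.update_self]
  have hEo : ∀ e, e ≠ e₁ → e ≠ e₂ → ends₁ e = ends e := by
    intro e h1 h2
    simp only [hends₁, Function.update_of_ne h1, Function.update_of_ne h2]
  -- in `ends₁` every edge at `d` is a loop
  have hiso : ∀ e, d ∈ ends₁ e → ω e = true → (ends₁ e).IsDiag := by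
    intro e hde _
    by_cases h1 : e = e₁
    · subst h1
      rw [hE₁] at hde
      rcases Sym2.mem_iff.1 hde with rfl | rfl
      · exact absurd rfl hx
      · exact absurd rfl hy
    by_cases h2 : e = e₂
    · subst h2; rw [hE₂]; simp
    rw [hEo e h1 h2] at hde ⊢
    by_contra hnd
    rcases hd e hde hnd with h | h
    · exact h1 h
    · exact h2 h
  constructor
  · intro h
    let S : Set V := {w | Conn ends₁ ω a w} ∪
      {w | w = d ∧ ω e₁ = true ∧ (Conn ends₁ ω a x ∨ Conn ends₁ ω a y)}
    -- with `e₁` open, `x ↔ y` in `ends₁`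
    have hxy : ω e₁ = true → Conn ends₁ ω x y := fun ho => conn_of_openAdj ⟨e₁, ho, hE₁⟩
    have hmem : b ∈ S := by
      refine mem_of_conn_of_closed (S := S) ?_ (Or.inl (conn_refl _ _ _)) h
      intro u hu w huw
      obtain ⟨hne', e, he, hends⟩ := openGraph_adj.1 huw
      by_cases h1 : e = e₁
      · subst h1
        rw [h₁] at hends
        rcases Sym2.eq_iff.1 hends with ⟨rfl, rfl⟩ | ⟨rfl, rfl⟩
        · rcases hu with hu | ⟨_, _, hv | hv⟩
          · exact absurd (eq_of_conn_of_loops hiso hu) ha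
          · exact Or.inl hv
          · exact Or.inl (conn_trans hv (conn_symm (hxy he)))
        · rcases hu with hu | ⟨huv, _, _⟩
          · exact Or.inr ⟨rfl, he, Or.inl hu⟩
          · exact absurd huv hne'
      by_cases h2 : e = e₂
      · subst h2
        rw [h₂] at hends
        have ho : ω e₁ = true := by rw [hc]; exact he
        rcases Sym2.eq_iff.1 hends with ⟨rfl, rfl⟩ | ⟨rfl, rfl⟩
        · rcases hu with hu | ⟨_, _, hv | hv⟩
          · exact absurd (eq_of_conn_of_loops hiso hu) ha
          · exact Or.inl (conn_trans hv (hxy ho))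
          · exact Or.inl hv
        · rcases hu with hu | ⟨huv, _, _⟩
          · exact Or.inr ⟨rfl, ho, Or.inr hu⟩
          · exact absurd huv hne'
      have hends' : ends₁ e = s(u, w) := by rw [hEo e h1 h2]; exact hends
      rcases hu with hu | ⟨rfl, _, _⟩
      · exact Or.inl (conn_trans hu (conn_of_openAdj ⟨e, he, hends'⟩))
      · have hde : u ∈ ends e := by rw [hends]; exact Sym2.mem_mk_left _ _
        have hnd : ¬ (ends e).IsDiag := fun hdg => not_openGraph_adj_of_isDiag hdg hends hne'
        rcases hd e hde hnd with h | h
        · exact absurd h h1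
        · exact absurd h h2
    rcases hmem with hmem | ⟨rfl, _, _⟩
    · exact hmem
    · exact absurd rfl hb
  · intro h
    refine mem_of_conn_of_closed (S := {w | Conn ends ω a w}) ?_ (conn_refl _ _ _) h
    intro u hu w huw
    obtain ⟨hne', e, he, hends⟩ := openGraph_adj.1 huw
    by_cases h2 : e = e₂
    · subst h2
      rw [hE₂] at hends
      exact absurd (not_openGraph_adj_of_isDiag (by simp) hends hne') id
    by_cases h1 : e = e₁
    · subst h1
      rw [hE₁] at hends
      -- `x ↔ y` in `ends` through `d`: both `e₁` and `e₂` are open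
      have ho₂ : ω e₂ = true := by rw [← hc]; exact he
      have hxd : Conn ends ω x d := conn_symm (conn_of_openAdj ⟨e, he, h₁⟩)
      have hdy : Conn ends ω d y := conn_of_openAdj ⟨e₂, ho₂, h₂⟩
      have hxy : Conn ends ω x y := conn_trans hxd hdy
      rcases Sym2.eq_iff.1 hends with ⟨rfl, rfl⟩ | ⟨rfl, rfl⟩
      · exact conn_trans hu hxy
      · exact conn_trans hu (conn_symm hxy)
    rw [hEo e h1 h2] at hends
    exact conn_trans hu (conn_of_openAdj ⟨e, he, hends⟩)

/-- **Series transfer, mixed colours.** If the non-loop edges at `d` are exactly `e₁ = {d, x}` and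
`e₂ = {d, y}` and `ω` gives them different colours, then `d` is a dead end: for `a, b ≠ d` the
connection `a ↔ b` is the same after both edges are made loops. -/
lemma conn_series_mixed_iff {ω : Config E} {e₁ e₂ : E} {d x y : V}
    (hd : ∀ e, d ∈ ends e → ¬ (ends e).IsDiag → e = e₁ ∨ e = e₂)
    (h₁ : ends e₁ = s(d, x)) (h₂ : ends e₂ = s(d, y))
    (hc : ω e₁ ≠ ω e₂) {a b : V} (ha : a ≠ d) (hb : b ≠ d) :
    Conn ends ω a b ↔
      Conn (Function.update (Function.update ends e₁ s(d, d)) e₂ s(d, d)) ω a b := by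
  set ends₀ := Function.update (Function.update ends e₁ s(d, d)) e₂ s(d, d) with hends₀
  have hne : e₁ ≠ e₂ := by
    rintro rfl; exact hc rfl
  have hE₁ : ends₀ e₁ = s(d, d) := by
    simp only [hends₀, Function.update_of_ne hne, Function.update_self]
  have hE₂ : ends₀ e₂ = s(d, d) := by simp only [hends₀, Function.update_self]
  have hEo : ∀ e, e ≠ e₁ → e ≠ e₂ → ends₀ e = ends e := by
    intro e h1 h2
    simp only [hends₀, Function.update_of_ne h1, Function.update_of_ne h2]
  have hiso : ∀ e, d ∈ ends₀ e → ω e = true → (ends₀ e).IsDiag := by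
    intro e hde _
    by_cases h1 : e = e₁
    · subst h1; rw [hE₁]; simp
    by_cases h2 : e = e₂
    · subst h2; rw [hE₂]; simp
    rw [hEo e h1 h2] at hde ⊢
    by_contra hnd
    rcases hd e hde hnd with h | h
    · exact h1 h
    · exact h2 h
  constructor
  · intro h
    let S : Set V := {w | Conn ends₀ ω a w} ∪
      {w | w = d ∧ ((ω e₁ = true ∧ Conn ends₀ ω a x) ∨ (ω e₂ = true ∧ Conn ends₀ ω a y))}
    have hmem : b ∈ S := by
      refine mem_of_conn_of_closed (S := S) ?_ (Or.inl (conn_refl _ _ _)) h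
      intro u hu w huw
      obtain ⟨hne', e, he, hends⟩ := openGraph_adj.1 huw
      by_cases h1 : e = e₁
      · subst h1
        rw [h₁] at hends
        rcases Sym2.eq_iff.1 hends with ⟨rfl, rfl⟩ | ⟨rfl, rfl⟩
        · rcases hu with hu | ⟨_, ⟨_, hv⟩ | ⟨ho₂, _⟩⟩
          · exact absurd (eq_of_conn_of_loops hiso hu) ha
          · exact Or.inl hv
          · exact absurd (he.trans ho₂.symm) hc
        · rcases hu with hu | ⟨huv, _⟩
          · exact Or.inr ⟨rfl, Or.inl ⟨he, hu⟩⟩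
          · exact absurd huv hne'
      by_cases h2 : e = e₂
      · subst h2
        rw [h₂] at hends
        rcases Sym2.eq_iff.1 hends with ⟨rfl, rfl⟩ | ⟨rfl, rfl⟩
        · rcases hu with hu | ⟨_, ⟨ho₁, _⟩ | ⟨_, hv⟩⟩
          · exact absurd (eq_of_conn_of_loops hiso hu) ha
          · exact absurd (ho₁.trans he.symm) hc
          · exact Or.inl hv
        · rcases hu with hu | ⟨huv, _⟩
          · exact Or.inr ⟨rfl, Or.inr ⟨he, hu⟩⟩
          · exact absurd huv hne'
      have hends' : ends₀ e = s(u, w) := by rw [hEo e h1 h2]; exact hends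
      rcases hu with hu | ⟨rfl, _⟩
      · exact Or.inl (conn_trans hu (conn_of_openAdj ⟨e, he, hends'⟩))
      · have hde : u ∈ ends e := by rw [hends]; exact Sym2.mem_mk_left _ _
        have hnd : ¬ (ends e).IsDiag := fun hdg => not_openGraph_adj_of_isDiag hdg hends hne'
        rcases hd e hde hnd with h | h
        · exact absurd h h1
        · exact absurd h h2
    rcases hmem with hmem | ⟨rfl, _⟩
    · exact hmem
    · exact absurd rfl hb
  · intro h
    exact conn_of_conn_update_loop (conn_of_conn_update_loop h)

end Transfer

end M9Reduce

end Summit.Ventures.PercRepro2
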